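import Summits.CriticalPhenomena.PercolationContinuityZ3.Theorems.Transplant.SharpnessGridWedge
import Summits.CriticalPhenomena.PercolationContinuityZ3.Theorems.Transplant.SharpnessGridWalks
import Summits.CriticalPhenomena.PercolationContinuityZ3.Theorems.Transplant.SharpnessHalfSpaceNotQuasiTransitive
import HarnessLib

/-!
# Transplant sharpness XXXI — the gridded log-wedge is NOT quasi-transitive

builds on p205010 (kernel theorem, internal audit signed; external expert review pending).
Status sentence (coordinator 2026-08-20T04:30Z): "θ(p_c) = 0 on ℤ^d, all d ≥ 2 — kernel-verified (Lean 4/Mathlib,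
standard axioms); internal adversarial audit SIGNED 2026-08-20 04:29Z; external expert review pending."

Lane `prim-bschramm`, seat p5 (sharpness); memo `run/shared/lean/prim/bschramm/P5-SHARPNESS.md` §40.2 / §42 (row 83,
column "NOT q.t.").  For `G′_M = ℤ²[logWedge a b ∪ gridLines M]` (`a > 0`, `b ≥ 0`, `M ≥ 2`) we prove that the tree's
`IsQuasiTransitive` (Benjamini–Schramm's "almost transitive": finitely many `Aut`-orbits) FAILS.  Invariant used: the
DEPTH of a vertex — "every vertex at walk-distance `< n` has `4` neighbours" (`Deep n`) is preserved by every automorphism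
(`Deep.map`: automorphisms preserve neighbour counts — `ncard_neighborSet_map` of `SharpnessHalfSpaceNotQuasiTransitive` —
and map walks to walks of the same length); the vertex
`(n + ⌈e^{2n/a}⌉, n)` of the wedge is `n`-deep (`exists_deep`: its `ℓ¹`-ball of radius `n` lies in the wedge, and walks are
`ℓ¹`-Lipschitz, `l1_le_length_induce`), while every vertex is joined to the corner `(-1, 0)` of degree `< 4`
(`SharpnessGridWalks.exists_walk_length_le_of_wedge_grid`), so a finite set of orbit representatives has bounded depth —
contradiction.  PROVED:

* `ncard_neighborSet_gridWedge_eq`, `ncard_neighborSet_of_forall_mem` (`= 2·2`), `ncard_neighborSet_lt_of_not_mem`;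
* `corner_mem_gridWedge`, `cornerUp_not_mem_gridWedge` — `(-1,0) ∈ L_M`, `(-1,1) ∉ W ∪ L_M` (`M ≥ 2`);
* `Deep`, `Deep.mono`, `Deep.map`, `not_deep_of_walk`, `exists_deep`;
* `not_isQuasiTransitive_gridWedgeGraph` — **`G′_M` is not quasi-transitive** (`a > 0`, `b ≥ 0`, `M ≥ 2`).

References: I. Benjamini, O. Schramm, Electron. Comm. Probab. 1 (1996), §2 ("almost transitive") and Conj. 4;
G. Grimmett, *Percolation*, 2nd ed. (1999), §11.5 p. 306.
-/

noncomputable section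

namespace Summit.CriticalPhenomena.PercolationContinuityZ3.Theorems.TransplantSharpness

open Literature.Probability.LatticeModels Literature.Barriers.CriticalPhenomena
open Literature.Barriers.CriticalPhenomena (IsQuasiTransitive)

variable {a b : ℝ} {M : ℕ}

/-! ## Neighbour counts in `G′` -/

/-- The neighbours of `v` in `G′ = ℤ²[S]`, seen in `ℤ²`, are the lattice neighbours of `v` lying in `S`. [folklore] -/
theorem image_val_neighborSet_gridWedge (v : gridWedge a b M) :
    Subtype.val '' ((gridWedgeGraph a b M).neighborSet v) =
      {y | (zdGraph 2).Adj (v : Site 2) y ∧ y ∈ gridWedge a b M} := by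
  ext y
  simp only [Set.mem_image, SimpleGraph.mem_neighborSet, Set.mem_setOf_eq]
  constructor
  · rintro ⟨w, hw, rfl⟩
    exact ⟨(SimpleGraph.comap_adj).1 hw, w.2⟩
  · rintro ⟨hadj, hy⟩
    exact ⟨⟨y, hy⟩, (SimpleGraph.comap_adj).2 hadj, rfl⟩

/-- The neighbour count of `v` in `G′` equals the number of lattice neighbours of `v` inside `S`. [folklore] -/
theorem ncard_neighborSet_gridWedge_eq (v : gridWedge a b M) :
    ((gridWedgeGraph a b M).neighborSet v).ncard = {y | (zdGraph 2).Adj (v : Site 2) y ∧ y ∈ gridWedge a b M}.ncard := by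
  rw [← image_val_neighborSet_gridWedge, Set.ncard_image_of_injective _ Subtype.val_injective]

/-- A vertex all of whose lattice neighbours lie in `S` has `4` neighbours in `G′`. [folklore] -/
theorem ncard_neighborSet_of_forall_mem (v : gridWedge a b M)
    (h : ∀ y : Site 2, (zdGraph 2).Adj (v : Site 2) y → y ∈ gridWedge a b M) :
    ((gridWedgeGraph a b M).neighborSet v).ncard = 2 * 2 := by
  rw [ncard_neighborSet_gridWedge_eq]
  have : {y | (zdGraph 2).Adj (v : Site 2) y ∧ y ∈ gridWedge a b M} = (zdGraph 2).neighborSet (v : Site 2) := by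
    ext y
    simp only [Set.mem_setOf_eq, SimpleGraph.mem_neighborSet, and_iff_left_iff_imp]
    exact h y
  rw [this, ← SimpleGraph.coe_neighborFinset, Set.ncard_coe_finset]
  exact card_neighborFinset_zdGraph_holds (v : Site 2)

/-- A vertex with a lattice neighbour outside `S` has fewer than `4` neighbours in `G′`. [folklore] -/
theorem ncard_neighborSet_lt_of_not_mem (v : gridWedge a b M) {y : Site 2} (hy : (zdGraph 2).Adj (v : Site 2) y)
    (hyS : y ∉ gridWedge a b M) : ((gridWedgeGraph a b M).neighborSet v).ncard < 2 * 2 := by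
  rw [ncard_neighborSet_gridWedge_eq, ← card_neighborFinset_zdGraph_holds (v : Site 2), ← Set.ncard_coe_finset,
    SimpleGraph.coe_neighborFinset]
  refine Set.ncard_lt_ncard ?_ (SimpleGraph.neighborSet (zdGraph 2) (v : Site 2)).toFinite
  constructor
  · intro z hz
    exact hz.1
  · intro hsub
    exact hyS (hsub hy).2

/-! ## The corner `(-1, 0)`: a vertex of degree `< 4` -/

/-- The corner point `(-1, 0)`. House notation. -/
def corner : Site 2 := ![-1, 0]

/-- `(-1, 0)` lies on the horizontal grid line `x₁ = 0`, hence in `S`. [folklore] -/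
theorem corner_mem_gridWedge (a b : ℝ) (M : ℕ) : corner ∈ gridWedge a b M := by
  refine gridLines_subset_gridWedge a b M ?_
  simp [gridLines, corner]

/-- `(-1, 1)` is not in `S` (`M ≥ 2`): not in the wedge (`x₀ < 0`) and on no grid line (`M ∤ ±1`). [folklore] -/
theorem cornerUp_not_mem_gridWedge (a b : ℝ) (hM : 2 ≤ M) : (![-1, 1] : Site 2) ∉ gridWedge a b M := by
  rintro (hW | hL)
  · have := hW.1
    simp at this
  · simp only [gridLines, Set.mem_setOf_eq, Matrix.cons_val_zero, Matrix.cons_val_one] at hL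
    have hM' : (1 : ℤ) < (M : ℤ) := by exact_mod_cast hM
    rcases hL with h | h
    · have h' : (M : ℤ) ∣ 1 := by
        have := h.neg_right
        simpa using this
      exact absurd (Int.le_of_dvd one_pos h') (not_le.2 hM')
    · exact absurd (Int.le_of_dvd one_pos h) (not_le.2 hM')

/-- The corner has a lattice neighbour outside `S`, so fewer than `4` neighbours in `G′`. [folklore] -/
theorem ncard_neighborSet_corner_lt (a b : ℝ) (hM : 2 ≤ M) :
    ((gridWedgeGraph a b M).neighborSet ⟨corner, corner_mem_gridWedge a b M⟩).ncard < 2 * 2 := by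
  refine ncard_neighborSet_lt_of_not_mem _ (y := ![-1, 1]) ?_ (cornerUp_not_mem_gridWedge a b hM)
  rw [zdGraph_adj_iff]
  refine ⟨1, Or.inl ?_⟩
  funext k
  fin_cases k <;> simp [corner]

/-! ## Depth: an automorphism invariant -/

/-- `v` is `n`-DEEP: every vertex at walk-distance `< n` from `v` has `4` neighbours in `G′`. House notation. -/
def Deep (n : ℕ) (v : gridWedge a b M) : Prop :=
  ∀ (u : gridWedge a b M) (w : (gridWedgeGraph a b M).Walk v u), w.length < n →
    ((gridWedgeGraph a b M).neighborSet u).ncard = 2 * 2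

/-- Depth is monotone. [folklore] -/
theorem Deep.mono {m n : ℕ} (hmn : m ≤ n) {v : gridWedge a b M} (h : Deep n v) : Deep m v :=
  fun u w hw => h u w (lt_of_lt_of_le hw hmn)

/-- **Depth is preserved by every automorphism of `G′`.** [folklore] -/
theorem Deep.map {n : ℕ} {v : gridWedge a b M} (h : Deep n v) (γ : gridWedgeGraph a b M ≃g gridWedgeGraph a b M) :
    Deep n (γ v) := by
  intro u w hw
  -- pull the walk back along `γ⁻¹`
  have h4 := h (γ.symm u) ((w.map γ.symm.toHom).copy (RelIso.symm_apply_apply γ v) rfl)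
    (by rw [SimpleGraph.Walk.length_copy, SimpleGraph.Walk.length_map]; exact hw)
  rw [ncard_neighborSet_map γ.symm u] at h4
  exact h4

/-- A vertex joined by a walk of length `ℓ` to a vertex of degree `≠ 4` is not `(ℓ + 1)`-deep. [folklore] -/
theorem not_deep_of_walk {v u : gridWedge a b M} (w : (gridWedgeGraph a b M).Walk v u)
    (hu : ((gridWedgeGraph a b M).neighborSet u).ncard < 2 * 2) : ¬ Deep (w.length + 1) v :=
  fun h => (h u w (Nat.lt_succ_self _)).not_lt hu

/-! ## Deep vertices exist: the wedge contains arbitrarily large full balls -/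

/-- A lattice point with `x₀ ≥ ⌈e^{2n/a}⌉` and `0 ≤ x₁ ≤ 2n` lies in the wedge `logWedge a b` (`a > 0`, `b ≥ 0`):
`2n ≤ a log(x₀ + 1) ≤ f(x₀)`. [folklore] -/
theorem mem_logWedge_of_bounds (ha : 0 < a) (hb : 0 ≤ b) (n : ℕ) {x : Site 2}
    (h0 : (⌈Real.exp (2 * n / a)⌉₊ : ℤ) ≤ x 0) (h1 : 0 ≤ x 1) (h1' : x 1 ≤ 2 * (n : ℤ)) : x ∈ logWedge a b := by
  have hceil : Real.exp (2 * n / a) ≤ (⌈Real.exp (2 * n / a)⌉₊ : ℝ) := Nat.le_ceil _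
  have hx0 : (⌈Real.exp (2 * n / a)⌉₊ : ℝ) ≤ ((x 0 : ℤ) : ℝ) := by exact_mod_cast h0
  have hexp : 0 < Real.exp (2 * n / a) := Real.exp_pos _
  have hx0pos : (0 : ℝ) < ((x 0 : ℤ) : ℝ) + 1 := by linarith
  have hlog : 2 * (n : ℝ) / a ≤ Real.log (((x 0 : ℤ) : ℝ) + 1) := by
    rw [Real.le_log_iff_exp_le hx0pos]
    linarith
  have hlog0 : 0 ≤ Real.log (((x 0 : ℤ) : ℝ) + 1) := le_trans (by positivity) hlog
  have hlog1 : 0 ≤ Real.log (1 + Real.log (((x 0 : ℤ) : ℝ) + 1)) := Real.log_nonneg (by linarith)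
  refine ⟨?_, h1, ?_⟩
  · have : (0 : ℝ) ≤ ((x 0 : ℤ) : ℝ) := by linarith
    exact_mod_cast this
  · have h2n : ((x 1 : ℤ) : ℝ) ≤ 2 * (n : ℝ) := by exact_mod_cast h1'
    have hmul : 2 * (n : ℝ) ≤ a * Real.log (((x 0 : ℤ) : ℝ) + 1) := by
      have := mul_le_mul_of_nonneg_left hlog ha.le
      rwa [mul_div_cancel₀ _ ha.ne'] at this
    nlinarith [mul_nonneg hb hlog1]

/-- **Deep vertices exist**: the wedge vertex `(n + ⌈e^{2n/a}⌉, n)` is `n`-deep (`a > 0`, `b ≥ 0`). [folklore] -/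
theorem exists_deep (ha : 0 < a) (hb : 0 ≤ b) (M : ℕ) (n : ℕ) : ∃ v : gridWedge a b M, Deep n v := by
  set c : ℤ := (⌈Real.exp (2 * n / a)⌉₊ : ℤ) with hc
  set x : Site 2 := ![(n : ℤ) + c, (n : ℤ)] with hx
  have hc0 : 0 ≤ c := by rw [hc]; positivity
  have hxW : x ∈ logWedge a b :=
    mem_logWedge_of_bounds ha hb n (by simp [hx, hc]) (by simp [hx]) (by simp [hx]; omega)
  refine ⟨⟨x, logWedge_subset_gridWedge a b M hxW⟩, fun u w hw => ?_⟩
  -- `u` is `ℓ¹`-close to `x`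
  have hl1 := l1_le_length_induce w
  have hlen : (w.length : ℤ) ≤ (n : ℤ) - 1 := by omega
  simp only [hx, Matrix.cons_val_zero, Matrix.cons_val_one] at hl1
  refine ncard_neighborSet_of_forall_mem u fun y hy => logWedge_subset_gridWedge a b M ?_
  have hs := l1_step hy
  refine mem_logWedge_of_bounds ha hb n ?_ ?_ ?_
  · -- `y 0 ≥ c`
    have h1 : |(u : Site 2) 0 - ((n : ℤ) + c)| ≤ (n : ℤ) - 1 := by
      have := abs_nonneg ((u : Site 2) 1 - (n : ℤ)); linarith
    have h2 : |y 0 - (u : Site 2) 0| ≤ 1 := by have := abs_nonneg (y 1 - (u : Site 2) 1); linarith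
    rw [abs_le] at h1 h2
    linarith [h1.1, h2.1]
  · have h1 : |(u : Site 2) 1 - (n : ℤ)| ≤ (n : ℤ) - 1 := by
      have := abs_nonneg ((u : Site 2) 0 - ((n : ℤ) + c)); linarith
    have h2 : |y 1 - (u : Site 2) 1| ≤ 1 := by have := abs_nonneg (y 0 - (u : Site 2) 0); linarith
    rw [abs_le] at h1 h2
    linarith [h1.1, h2.1]
  · have h1 : |(u : Site 2) 1 - (n : ℤ)| ≤ (n : ℤ) - 1 := by
      have := abs_nonneg ((u : Site 2) 0 - ((n : ℤ) + c)); linarith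
    have h2 : |y 1 - (u : Site 2) 1| ≤ 1 := by have := abs_nonneg (y 0 - (u : Site 2) 0); linarith
    rw [abs_le] at h1 h2
    linarith [h1.2, h2.2]

/-! ## `G′` is not quasi-transitive -/

/-- **The gridded log-wedge `G′_M = ℤ²[W ∪ L_M]` is NOT quasi-transitive** (`a > 0`, `b ≥ 0`, `M ≥ 2`): every vertex is
joined to the corner `(-1,0)` (degree `< 4`), so the vertices of a finite set `V₀` have bounded depth `N`; an `N`-deep wedge
vertex cannot be moved into `V₀` by an automorphism, depth being invariant.  (Row 83 of P5-SHARPNESS: the graph that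
percolates at its own critical point inside the rough-isometry class of `ℤ²` is, as it must be by Benjamini–Schramm's
Conj. 4 if that conjecture holds, not quasi-transitive.) [cite: BenjaminiSchramm1996, §2 ("almost transitive") and Conj. 4] -/
theorem not_isQuasiTransitive_gridWedgeGraph (ha : 0 < a) (hb : 0 ≤ b) (hM : 2 ≤ M) :
    ¬ IsQuasiTransitive (gridWedgeGraph a b M) := by
  classical
  rintro ⟨V₀, hV₀⟩
  have hM1 : 1 ≤ M := le_trans (by norm_num) hM
  -- a walk from every vertex to the corner
  have hwalk : ∀ v : gridWedge a b M,
      ∃ w : (gridWedgeGraph a b M).Walk v ⟨corner, corner_mem_gridWedge a b M⟩, True := by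
    intro v
    obtain ⟨w, -⟩ := exists_walk_length_le_of_wedge_grid (a := a) (b := b) (S := gridWedge a b M) (M := M)
      ha.le hb hM1 (logWedge_subset_gridWedge a b M) (fun z hz => Or.inr hz) (fun z hz => hz)
      (v : Site 2) corner v.2 (corner_mem_gridWedge a b M)
    exact ⟨w, trivial⟩
  choose f _ using hwalk
  set N : ℕ := V₀.sup fun v => (f v).length + 1 with hN
  obtain ⟨v, hv⟩ := exists_deep ha hb M N
  obtain ⟨γ, hγ⟩ := hV₀ v
  have hdeep : Deep N (γ v) := hv.map γ
  have hle : (f (γ v)).length + 1 ≤ N := Finset.le_sup (f := fun v : gridWedge a b M => (f v).length + 1) hγ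
  exact not_deep_of_walk (f (γ v)) (ncard_neighborSet_corner_lt a b hM) (hdeep.mono hle)

end Summit.CriticalPhenomena.PercolationContinuityZ3.Theorems.TransplantSharpness

end
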